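import Summits.BirchSwinnertonDyer.BirchSwinnertonDyer.Theorems.UniversalToricDescentPeuRamifieMultTwinResupplyOrdinaryAtThree
import Summits.BirchSwinnertonDyer.Rank1Residual.X11a.Cells
import HarnessLib

/-!
# Crux `X11aLowerHalf` (item stmt-BirchSwinnertonDyer-19064), line «birth» r7 — the registered stub `stub_partnerThree`
# PROVED, fact-free: every multiplicative-at-3 curve with `3 ∣ ord₃ Δ_min` has a GOOD ORDINARY 3-congruent partner
# (lead bsd-line-x11a-p1 gen 2; `--supports stmt-BirchSwinnertonDyer-19064`, stub `stub_partnerThree` by name and signature)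

HONEST FRAMING. One theorem with EXACTLY the registered signature of `stub_partnerThree` (skeleton sha16 9f7978fe,
`Cruxes/X11aLowerHalf/Lines/birth.lean` r7, l. 199–209) and its hypothesis-free core; no definition, no named fact, no `sorry`;
axioms standard.  It closes ONE registered stub of the line; it closes no item and proves BSD for no curve: after it, crux L
still rests on item 19948, Greenberg's analytic `μ = 0` on the deep surjective X11a pairs at `p ≥ 5`, the très-ramifié open core
at `p = 3`, and 27 named published facts.  beyond-print theorem: the STATEMENT («a peu-ramifié multiplicative curve at 3 has a
good ordinary 3-congruent twin over ℚ») is folklore-by-moduli (`X_E(3) ≅ ℙ¹` + Serre–Tate + weak approximation) with no printed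
locus known to the cell; the tree PROVES it by an explicit Hesse-pencil member.

## What and how

The r7 cut of the `p = 3` residual (width seat er5-p2 g4, adopted by the lead) asks, on the finite-flat off-Kodaira deep X11a
locus at 3, for a globally minimal `A/ℚ` with good ORDINARY reduction at 3 and a `Γ_ℚ`-equivariant `E[3] ≃+ A[3]`.  The route
`UniversalToricDescent` (cell bsd-wall-utd, width seat p2-w2 g3) has ALREADY proved exactly this existence for EVERY globally
minimal curve multiplicative at 3 with `3 ∣ v₃(Δ_min)`:
`UniversalToricDescentPeuRamifieResupply.exists_goodOrd_twin_of_mult_of_three_dvd_padicValInt` — the partner is a global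
minimal model of the Hesse-pencil member at `(−c₆ + 3^{v₃(Δ)/3} c₄ : c₄)` (Fisher 2012 Thm 13.2, `n = 3`, PROVED in the tree as
`Fisher2012.thm132_threeCongruent_hessePencil_holds`), shown good at 3 by an explicit integer model with `3 ∤ Δ` and ordinary by
`a₃ ≡ b₂ = 4ρ ≢ 0 (mod 3)` (Hasse invariant).  Its conclusion `O6.ModPCongruent A W 3 ∧ GoodOrd A 3` unfolds to the stub's
conclusion with the isomorphism reversed; §1 reverses it (an equivariant additive isomorphism has an equivariant inverse) and
§2 is the stub VERBATIM — its X11a, deep, and off-Kodaira hypotheses are simply not needed.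

References: [Fisher2012Hessian] Thm. 13.2; [SilvermanAEC2009] V.4.1 (a), VII.5 Prop. 5.1; [AnemaTopTuijp2018] Thm. 1.1 (the
Hesse pencil is the universal symplectic family at 3); cell files `Cruxes/X11aLowerHalf/Lines/birth.lean` r7, `LEAD-g2-VERDICT.md`,
`pub/bsd-stepL/line-er5-p2/g4/PARTNER-ROAD.md`.
-/

set_option autoImplicit false
set_option linter.dupNamespace false -- the directory name repeats the summit name (sibling precedent)

noncomputable section

open scoped Classical

open WeierstrassCurve IsDedekindDomain Rat.HeightOneSpectrum
  Literature.NumberTheory.EllipticCurves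
  Literature.NumberTheory.EllipticCurves.Rank1Residual
  Literature.NumberTheory.EllipticCurves.Rank1Residual.Typed
  Summit.BirchSwinnertonDyer.Rank1Residual
  Summit.BirchSwinnertonDyer.BirchSwinnertonDyer.Theorems.UniversalToricDescentPeuRamifieResupply

namespace Summit.BirchSwinnertonDyer.BirchSwinnertonDyer.Theorems.Birth

/-! ## §1 The hypothesis-free core: a good ORDINARY 3-congruent partner of a peu-ramifié multiplicative curve -/

/-- **Every globally minimal elliptic curve `W/ℚ` with multiplicative reduction at `3` and `3 ∣ ord₃ Δ_min(W)` (i.e. `W[3]`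
finite flat at `3`) has a globally minimal `3`-congruent partner `A/ℚ` with GOOD ORDINARY reduction at `3`**, the congruence
being a `Γ_ℚ`-equivariant additive isomorphism `W[3] ≃+ A[3]` of geometric `3`-torsion.  This is the tree theorem
`exists_goodOrd_twin_of_mult_of_three_dvd_padicValInt` (route `UniversalToricDescent`; explicit Hesse-pencil member, Fisher 2012
Thm. 13.2 proved in the tree) with the isomorphism inverted. [cite: Fisher2012Hessian, Thm. 13.2 (n = 3)]
[cite: SilvermanAEC2009, V.4.1 (a) and VII.5 Prop. 5.1] -/
theorem exists_goodOrdinary_threeCongruent_partner (W : WeierstrassCurve ℚ) [W.IsElliptic] [W.IsGloballyMinimal]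
    (hm : W.HasMultiplicativeReductionAtPrime 3) (hdvd : 3 ∣ padicValInt 3 W.minimalDiscriminantInt) :
    ∃ (A : WeierstrassCurve ℚ) (_ : A.IsElliptic) (_ : A.IsGloballyMinimal),
      A.HasGoodReductionAtPrime 3 ∧ ¬ (3 : ℤ) ∣ A.frobeniusTrace 3 ∧
      ∃ e : geomTorsion W (3 : ℤ) ≃+ geomTorsion A (3 : ℤ),
        ∀ (σ : Field.absoluteGaloisGroup ℚ) (P : geomTorsion W (3 : ℤ)), e (σ • P) = σ • e P := by
  obtain ⟨A, hAE, hAM, ⟨e, he⟩, hgood, hord⟩ := exists_goodOrd_twin_of_mult_of_three_dvd_padicValInt W hm hdvd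
  refine ⟨A, hAE, hAM, hgood, by exact_mod_cast hord, e.symm, fun σ P => ?_⟩
  apply e.injective
  rw [he, AddEquiv.apply_symm_apply, AddEquiv.apply_symm_apply]

/-! ## §2 The registered stub `stub_partnerThree` of line «birth» r7, VERBATIM -/

/-- **Registered stub `stub_partnerThree` of crux L's line «birth» r7 (skeleton sha16 9f7978fe), PROVED**: at every deep X11a
pair with `p = 3` off the Kodaira sub-locus whose `E[3]` is finite flat at `3` (`3 ∣ ord₃ Δ_min`), there is a globally minimal
`A/ℚ` with good ORDINARY reduction at `3` and a `Γ_ℚ`-equivariant additive isomorphism `E[3] ≃+ A[3]`.  Only `Mult W 3` (from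
`ClassX11a`) and the finite-flat hypothesis are used; the deep, X11a and off-Kodaira hypotheses are idle (the statement holds for
every peu-ramifié multiplicative curve at 3, §1).  Fact-free. [cite: Fisher2012Hessian, Thm. 13.2 (n = 3)]
[cite: SilvermanAEC2009, VII.5 Prop. 5.1] -/
theorem stub_partnerThree :
    ∀ (W : WeierstrassCurve ℚ) [W.IsElliptic] [W.IsGloballyMinimal] (p : ℕ) [Fact p.Prime],
      ClassX11a W p → p = 3 → ¬ X11a.ShaAnUnit W p →
      ¬ (Surj W p ∧ ∃ v : IsDedekindDomain.HeightOneSpectrum ℤ, W.HasAdditiveReductionAt v ∧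
          3 ∣ (W.kodairaSymbolAt v).componentGroupOrder ∧
          ¬ Rat.HeightOneSpectrum.natGenerator v ^ 3 ∣ W.conductorNorm ℤ) →
      p ∣ padicValInt p W.minimalDiscriminantInt →
      ∃ (A : WeierstrassCurve ℚ) (_ : A.IsElliptic) (_ : A.IsGloballyMinimal),
        A.HasGoodReductionAtPrime p ∧ ¬ (p : ℤ) ∣ A.frobeniusTrace p ∧
        ∃ e : geomTorsion W (p : ℤ) ≃+ geomTorsion A (p : ℤ),
          ∀ (σ : Field.absoluteGaloisGroup ℚ) (P : geomTorsion W (p : ℤ)), e (σ • P) = σ • e P := by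
  intro W _ _ p _ hX hp _ _ hdvd
  subst hp
  exact exists_goodOrdinary_threeCongruent_partner W hX.2.2.1 hdvd

end Summit.BirchSwinnertonDyer.BirchSwinnertonDyer.Theorems.Birth

end
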